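import Summits.QuantumFields.YangMills.Theorems.BalabanUVNodesPortS1G3CDefs

/-!
# Porter hand `hand-27930-G3C` (g0) — `stub_G3C : ∀ F, G3CAtRecord F` of ⟨stmt-QuantumFields-27930⟩, line `pta_residueW` (skeleton 87bdd1ccb8dbbbe8):
# THE LOCATED OBSTRUCTION, TYPED, and the REPAIRED LETTER `G3CAtRecordL` (= `G3CAtRecord` over the body `P0CarrierClauses ∧ P0CarrierLatticeDecay`)

VERDICT (hand g0, 2026-08-31): `G3CAtRecord F` is NOT DERIVABLE from its antecedent `P0CarrierClauses` — the cut between `stub_P0C` and `stub_G3C`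
drops the one structural letter the generalized random walk expansion runs on.  `P0CarrierClauses` (P4) bounds the pieces `TY n Y φ` in SCHUR norm by
`c₀·e^{−δ₀·dj Y}` where `dj` is the CUBE-SCALE tree length (`torusTreeLen`, closed unit cubes): `dj Y = 0` for every `Y` inside a vertex star (up to
`2⁴ = 16` cubes — e.g. two wall-adjacent cubes), so the inter-cube couplings of the carrier are constrained by `‖·‖ ≤ c₀` ONLY, uniformly in `Mc` and `δ₀`.
Print's mechanism for «κ can be arbitrarily large if M₁ is sufficiently large» ([16] (25) p.262) is the per-step factor `O(M^{−1/2})^{|ω|}` of (23) p.262 =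
[B9] (3.89)/(3.94) p.409–410, which comes from the SEMI-LOCALITY AT THE UNIT-LATTICE SCALE of `Δ′`: the commutator `K(h_□) = [Δ′, h_□]` with a partition
of unity `h_□` that is `1/M`-Lipschitz in LATTICE distance, and the lattice-scale Combes–Thomas decay of the local inverses `G′_□`.  Both need a bound of
the carrier's kernel against the level-`k` LATTICE distance `Site.tdist i.src j.src` — (P4-lat) below — which no clause of `P0CarrierClauses` states
((Z-supp)/(Z-loc)/(P4) are all cube-scale).  With cube-scale data only, the Combes–Thomas rate of `(x + T^{(X)}(φ))⁻¹` in cube units is at most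
`log(1 + γ₀/(32c₀))`-sized, `Mc`-independent; the toy carrier of `G3C-OBSTRUCTION-v1.md` §2 (a ring of cubes coupled wall-to-wall with Schur norm `t`,
diagonal `a`, `γ₀ = a − 2t`) satisfies every cube-scale clause and has NO local expansion of `Tr (x + T(φ))⁻¹` on an open configuration set with rate
`κ > κ₀ + 1 + 2·log(a/t)` (Cauchy estimate on the mixed second derivative vs. the exact resolvent), for any `Mc`.  The consumer (`PortRecordLZdetHalf`)
needs `κ ≥ 4·kappa₀ 64 8` + combinatorial margin — not available from `(c₀, γ₀)`.

WHAT THIS FILE TYPES (definitions + one trivial comparison; elaborates; NOT a proposal — the letter edition is DEF-1's / the planner's, D-0014):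
* `P0CarrierLatticeDecay F δ₀ c₀ δ₁ Mc α₀ α₁ k TY` — (P4-lat): on the record space of `Y`, the SCHUR row and column sums of `TY n Y φ` WEIGHTED BY
  `exp(δ₁ · tdist_k(i.src, j.src))` (level-`k` lattice units, `δ₁ > 0` absolute = a fraction of print's propagator decay rate, [B9] (3.42) p.399 /
  [15] (190)) are `≤ c₀·e^{−δ₀·dj Y}`.  It implies (P4)'s Schur clause (weight ≥ 1) and is what the physical (2.11) carrier `C_locᵀ Δ^{(k)} C_loc` has.
* `G3CAtRecordL F` — the REPAIRED letter: `G3CAtRecord`'s prefix with `δ₁` quantified next to `c₀ γ₀ γ₁` (the thresholds `δG, Mth'` may depend on it)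
  and the body `P0CarrierClauses … → P0CarrierLatticeDecay … → ∃ EG EGZ, G3CPiecesAt …` (conclusion UNCHANGED, so the glue `stub_LZdetGlue` reads it
  verbatim once `stub_P0C`'s letter supplies (P4-lat): `P0HolExtAtRecordL := ∃ c₀ γ₀ γ₁ δ₁, … ∃ carriers, P0CarrierClauses ∧ P0CarrierLatticeDecay`).
* `g3cAtRecordL_of_g3cAtRecord` — the repaired letter is IMPLIED by the letter of record (it only adds a hypothesis): the recut loses nothing.

HONEST FRAMING.  Typed statements + a one-line weakening; nothing of Bałaban asserted or proved; `stub_G3C` NOT closed (verdict: mis-cut letter);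
`G3CAtRecordL` is the honest complex ∕ field-localised ∕ torus edition of [B4] (5.17) (hypothesis (5.6) = coercivity + LATTICE kernel decay — exactly
(P5ᶜ) + (P4-lat)), L–XL, inhabited nowhere; 27930 OPEN; NODE O 0∕1; COUNT 8∕28 · K 1∕4 UNMOVED; finite 𝕋⁴ at fixed ε — NOT continuum ∕ OS ∕ Clay;
**the Yang–Mills mass gap is NOT proved by any of this.**  No `sorry`, no `instance`, no `notation`; standard axioms.
[16] = Balaban1985UV3 (CMP 102), [B9] = Balaban1985BackgroundPropagators (CMP 99), [B4] = Balaban1984PropagatorsI, [15] = Balaban1985Variational, [I] = Balaban1987RG1.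
-/

noncomputable section

open scoped BigOperators Matrix.Norms.L2Operator Topology
open Filter

namespace Summit.QuantumFields.YangMills.Cruxes.PortRecordRepresentationS1.PtaResidueW.G3CHand

open Summit.QuantumFields.YangMills.Theorems.K0RecordFormatNames
open Summit.QuantumFields.YangMills.Theorems.BalabanUVNodesPortS1
open Literature.MathematicalPhysics.QuantumFieldTheory.Balaban1983to89
open Literature.MathematicalPhysics.QuantumFieldTheory.Balaban1983to89.Node00
open Literature.MathematicalPhysics.QuantumFieldTheory.Balaban1983to89.T4Continuum (T4Family)

/-- **(P4-lat) LATTICE-SCALE SCHUR DECAY of the carrier pieces** — the letter the generalized random walk expansion runs on ([B9] (3.42) p.399 «|G′(y,y′)| ≤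
O(1) e^{−δ₀|y−y′|}» in UNIT-LATTICE distance; (3.89)/(3.94) p.409–410; [16] (23) p.262): on the record space of `Y`, for every row index `i`,
`Σ_j ‖TY n Y φ i j‖ · exp(δ₁ · tdist_k(i.src, j.src)) ≤ c₀ · exp(−δ₀ · dj Y)`, and the same for columns; `tdist_k` = `Site.tdist` on the level-`k` torus
(lattice units), `δ₁ > 0` absolute.  Implies (P4)'s unweighted Schur clause.  A predicate WITH PARAMETERS — asserts nothing.
[cite: Balaban1985BackgroundPropagators, (3.42) p.399, (3.89)–(3.94) p.409–410; Balaban1985UV3, (23) p.262; Balaban1983RegularityDecay, (5.6) p.594] -/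
def P0CarrierLatticeDecay (F : T4Family) (δ₀ c₀ δ₁ : ℝ) (Mc : ℕ) (α₀ α₁ : ℝ) (k : ℕ)
    (TY : (n : ℕ) → (recordDomSys F Mc k (recordK₀ F Mc k + n)).Dom → Sect2.CPair (F.P (recordK₀ F Mc k + n)) (MatA 2) →
        FluctIdx F k (recordK₀ F Mc k + n) → FluctIdx F k (recordK₀ F Mc k + n) → ℂ) : Prop :=
  ∀ (n : ℕ) (Y : (recordDomSys F Mc k (recordK₀ F Mc k + n)).Dom) (φ : Sect2.CPair (F.P (recordK₀ F Mc k + n)) (MatA 2)),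
    encodeCfg F (recordK₀ F Mc k + n) φ ∈ recordUc F Mc k α₀ α₁ (recordK₀ F Mc k + n) Y →
      (∀ i : FluctIdx F k (recordK₀ F Mc k + n),
        ∑ j : FluctIdx F k (recordK₀ F Mc k + n),
            ‖TY n Y φ i j‖ * Real.exp (δ₁ * (Site.tdist i.1.src j.1.src : ℝ)) ≤
          c₀ * Real.exp (-(δ₀ * (recordDomSys F Mc k (recordK₀ F Mc k + n)).dj Y))) ∧
      (∀ j : FluctIdx F k (recordK₀ F Mc k + n),
        ∑ i : FluctIdx F k (recordK₀ F Mc k + n),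
            ‖TY n Y φ i j‖ * Real.exp (δ₁ * (Site.tdist i.1.src j.1.src : ℝ)) ≤
          c₀ * Real.exp (-(δ₀ * (recordDomSys F Mc k (recordK₀ F Mc k + n)).dj Y)))

/-- **`G3CAtRecordL F` — THE REPAIRED G-P6 LETTER**: `G3CAtRecord` with the lattice rate `δ₁` quantified next to the absolute constants `c₀ γ₀ γ₁` (so the
thresholds `δG`, `Mth'` may answer to it) and (P4-lat) added to the body; the CONCLUSION `∃ EG EGZ, G3CPiecesAt …` is UNCHANGED.  This is the complex ∕
field-localised ∕ torus edition of [B4] (5.17) under (5.6) = (P5ᶜ) coercivity + (P4-lat) lattice kernel decay, «M sufficiently large» = `Mth'(κt, …)`.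
DISPLAYED; inhabited nowhere. [cite: Balaban1983RegularityDecay, (5.6) p.594, (5.17) p.40; Balaban1985UV3, (23)–(25) p.262, (63) p.272;
Balaban1985BackgroundPropagators, (3.90) p.409] -/
def G3CAtRecordL (F : T4Family) : Prop :=
  ∀ κt : ℝ, 0 < κt →
  ∀ c₀ γ₀ γ₁ δ₁ : ℝ, 0 < c₀ → 0 < γ₀ → γ₀ ≤ γ₁ → 0 < δ₁ →
  ∃ δG : ℝ, 0 < δG ∧ ∃ Mth' : ℕ,
  ∀ δ₀ : ℝ, δG ≤ δ₀ → ∀ Mc : ℕ, Mth' ≤ Mc → McGuard F Mc →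
  ∃ Bc : ℝ, 0 ≤ Bc ∧
  ∀ a₀ α₀ α₁ ε₂₉ : ℝ, 0 < a₀ → 0 < α₀ → 0 < α₁ → 0 < ε₂₉ → ∀ (k : ℕ) TC TY TZY AdM AdZ,
    P0CarrierClauses F a₀ δ₀ c₀ γ₀ γ₁ Mc α₀ α₁ ε₂₉ k TC TY TZY AdM AdZ →
    P0CarrierLatticeDecay F δ₀ c₀ δ₁ Mc α₀ α₁ k TY →
    ∃ EG EGZ, G3CPiecesAt F Mc k a₀ ε₂₉ α₀ α₁ κt Bc TC EG EGZ

/-- **The letter of record implies the repaired letter** (the recut only ADDS the hypothesis (P4-lat) and the binder `δ₁`): nothing downstream is lost.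
[cite: Balaban1985UV3, (25) p.262 (bookkeeping)] -/
theorem g3cAtRecordL_of_g3cAtRecord (F : T4Family) (h : G3CAtRecord F) : G3CAtRecordL F := by
  intro κt hκt c₀ γ₀ γ₁ δ₁ hc₀ hγ₀ hγ _hδ₁
  obtain ⟨δG, hδG, Mth', hrest⟩ := h κt hκt c₀ γ₀ γ₁ hc₀ hγ₀ hγ
  refine ⟨δG, hδG, Mth', fun δ₀ hδ₀ Mc hMc hG => ?_⟩
  obtain ⟨Bc, hBc, hall⟩ := hrest δ₀ hδ₀ Mc hMc hG
  exact ⟨Bc, hBc, fun a₀ α₀ α₁ ε₂₉ ha₀ hα₀ hα₁ hε k TC TY TZY AdM AdZ hP _hL =>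
    hall a₀ α₀ α₁ ε₂₉ ha₀ hα₀ hα₁ hε k TC TY TZY AdM AdZ hP⟩

/-- **The repaired P0-ℂ letter** the recut asks of `stub_P0C`'s supplier (node00-def-Y M2-ℂ): `P0HolExtAtRecord`'s prefix with one more absolute constant
`δ₁ > 0` and the body `P0CarrierClauses ∧ P0CarrierLatticeDecay` (print: the (2.11) carrier `C_locᵀ Δ^{(k)} C_loc` is exponentially localized at the
UNIT-LATTICE scale, [15] (190) p.309 ∕ [B9] (3.42)).  DISPLAYED; inhabited nowhere. [cite: Balaban1985Variational, Prop. 9 p.309; Balaban1985BackgroundPropagators, (3.42) p.399] -/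
def P0HolExtAtRecordL (F : T4Family) : Prop :=
  ∃ c₀ γ₀ γ₁ δ₁ : ℝ, 0 < c₀ ∧ 0 < γ₀ ∧ γ₀ ≤ γ₁ ∧ 0 < δ₁ ∧
  ∀ δ₀ : ℝ, 0 < δ₀ → ∃ Mth : ℕ, ∀ Mc : ℕ, Mth ≤ Mc → McGuard F Mc →
  ∀ a₀ : ℝ, 0 < a₀ →
  ∃ α₀ α₁ : ℝ, 0 < α₀ ∧ 0 < α₁ ∧
  ∀ ε₂₉ : ℝ, 0 < ε₂₉ → ∀ k : ℕ,
    ∃ TC TY TZY AdM AdZ, P0CarrierClauses F a₀ δ₀ c₀ γ₀ γ₁ Mc α₀ α₁ ε₂₉ k TC TY TZY AdM AdZ ∧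
      P0CarrierLatticeDecay F δ₀ c₀ δ₁ Mc α₀ α₁ k TY

/-- **The repaired P0-ℂ letter implies the letter of record** (it only adds (P4-lat)): `stub_P0C`'s statement is unchanged in strength for every other consumer.
[cite: Balaban1985Variational, Prop. 9 p.309 (bookkeeping)] -/
theorem p0HolExtAtRecord_of_p0HolExtAtRecordL (F : T4Family) (h : P0HolExtAtRecordL F) : P0HolExtAtRecord F := by
  obtain ⟨c₀, γ₀, γ₁, _δ₁, hc₀, hγ₀, hγ, _hδ₁, hrest⟩ := h
  refine ⟨c₀, γ₀, γ₁, hc₀, hγ₀, hγ, fun δ₀ hδ₀ => ?_⟩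
  obtain ⟨Mth, hM⟩ := hrest δ₀ hδ₀
  refine ⟨Mth, fun Mc hMc hG a₀ ha₀ => ?_⟩
  obtain ⟨α₀, α₁, hα₀, hα₁, hk⟩ := hM Mc hMc hG a₀ ha₀
  refine ⟨α₀, α₁, hα₀, hα₁, fun ε₂₉ hε k => ?_⟩
  obtain ⟨TC, TY, TZY, AdM, AdZ, hP, -⟩ := hk ε₂₉ hε k
  exact ⟨TC, TY, TZY, AdM, AdZ, hP⟩

end Summit.QuantumFields.YangMills.Cruxes.PortRecordRepresentationS1.PtaResidueW.G3CHand

end
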